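/-
Copyright (c) 2026 the pub-hodgecm-mathlib formalisation cell (harness21).  Prover seat hodgecm-mathlib-K2Liu-p01 (g8), Track B «K2-LIT»,
#184♮ = hLiu418 = `stmt-HodgeConjecture-24832`; #42S organ S1 ROAD W, F7 LAST-FILE phase chain (SPEC-F7-PhaseChain e96aa88172f3bbd5 §2 (inv), §3 (Φ6)):
the valuation BOUND on the Rao phase from the boxes — `d·½⟨x, c_t x⟩ ∈ 𝔭^{a+b}` when `H_t ∈ ball_a` and `G ∈ ball_b` — feeding ★ (H) `unipOpPi_eq_self_of_support` (`hf₀inv`)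
and ★ (T1)'s `h0`, and the «⇐» half of the duality `hDW`.
-/
import Summits.HodgeConjecture.HodgeConjecture.Theorems.K2LiuWitnessPhaseTrace           -- ★∕📤 (Φ4) `toLocalRing_d_mul_half_pairing`
import Summits.HodgeConjecture.HodgeConjecture.Theorems.K2LiuLocalRingValuationBalls      -- ★ E-det balls: `mball_mul`, `ball_sum`, `mem_primePowBall_of_ball_toLocalRing` (Φ6)
import HarnessLib

/-!
# Crux `HLiu418`, #42S-S1 ROAD W, phase chain (Φ8): THE PHASE BOUND — `H_t ∈ ball_a ∧ G ∈ ball_b ⇒ d·½⟨x, c_t x⟩ ∈ 𝔭_v^{a+b}`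

Cell `hodgecm-mathlib`, crux item hLiu418 = `stmt-HodgeConjecture-24832` (helper lane `--supports … --as helper`, count-neutral).  THEOREMS ONLY (no `def`, no instance,
no notation, no named-fact hypothesis, no `sorry`).  GENERIC doubled local currency `(F, E, c, δ, d, v, n, T₀)` + the E-det uniformiser letter `(hπ : v π = exp(−1))`.

WHY (SPEC-F7-PhaseChain §2).  With ★∕📤 (Φ4) `ι(d·½y_t) = tr(H_t·G)` (`y_t = ⟨x, c_t x⟩` by ★ (T3a), `H_t = δ̂•𝕋₀t`, `G = hypGram(κ x)`), the E-det ball calculus (★ `mball_mul`, `ball_sum`) bounds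
`tr(H_t G) ∈ ball_{a+b}` for `H_t ∈ ball_a` (i.e. `t ∈ BOX`, ★ (B) p860277 with `e₂ = 0`) and `G ∈ ball_b` (the `S₁²`-box `b = 0`, or the cell condition `b = m`), and ★ (Φ6)
`mem_primePowBall_of_ball_toLocalRing` reads it in `L⁺_v`: **`d·½y_t ∈ 𝔭_v^{a+b}`**.  Consequences (caller, one line each with ★ (i-a) and `c₀ := m_ψ + v(d)`): `t ∈ BOX 0`, `G` integral ⇒
`ψ_v(−½y_t) = 1` (★ (H) `hfix` ⇒ `hf₀inv`; ★ (T1) `h0`); `t ∈ BOX m`, `G ∈ ϖ^m`-box ⇒ `e(t,x) = 1` (the «⇐» half of `hDW`).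
* `trace_mem_ball_of_mball` — `X ∈ ball_a`, `Y ∈ ball_b` ⇒ `tr(X·Y) ∈ ball_{a+b}`;   * **`d_mul_half_pairing_mem_primePowBall`** — the bound.
[CasselsFrohlichANT1967, Ch. II §10] [Weil1964, n° 13] [MoeglinVignerasWaldspurger1987, Chap. 2 II.6] [Shimura1997, §13.2].
HONEST LABEL.  Count-neutral helper; `HC_CM` is proved only modulo the 7 printed citations (2 remaining named inputs: hLiu418 = `stmt-HodgeConjecture-24832`,
h413 = `stmt-HodgeConjecture-24833`) until rung 0 closes.

## References
* [CasselsFrohlichANT1967] J. W. S. Cassels, A. Fröhlich (eds.), *Algebraic Number Theory* (1967), Ch. II §10.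
* [Weil1964] A. Weil, Acta Math. 111 (1964), n° 13.
* [MoeglinVignerasWaldspurger1987] C. Mœglin, M.-F. Vignéras, J.-L. Waldspurger, LNM 1291 (1987), Chap. 2 II.6.
* [Shimura1997] G. Shimura, CBMS 93 (1997), §13.2.
-/

set_option autoImplicit false
set_option linter.dupNamespace false -- the mandated namespace repeats `HodgeConjecture.HodgeConjecture`

noncomputable section

open NumberField IsDedekindDomain Matrix
open Literature.NumberTheory.Automorphic Literature.NumberTheory.Automorphic.UnitaryGroup
open Literature.NumberTheory.Automorphic.UnitaryGroup.QuadraticCoordinates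
open Literature.NumberTheory.GaloisRepresentations.IsNonarchimedeanLocalField
open Literature.NumberTheory.GelbartRogawski1991.UnitaryDualPair Literature.NumberTheory.GelbartRogawski1991.UnitaryDualPair.LocalSplitting

namespace Summit.HodgeConjecture.HodgeConjecture.Cruxes.HLiu418.K2LiuWitnessPhaseBound

open K2LiuWitnessPhaseTrace K2LiuLocalRingValuationBalls

variable (F : Type) [Field F] [NumberField F] (E : Type) [Field E] [NumberField E] [Algebra F E]
  [Algebra.IsQuadraticExtension F E] (c : E ≃ₐ[F] E)
  {δ : E} (hcδ : c δ = -δ) (hδ : δ ≠ 0) {d : F} (hd : δ * δ = algebraMap F E d)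
  (v : HeightOneSpectrum (𝓞 F)) {π : v.adicCompletion F} (hπ : Valued.v π = WithZero.exp (-1 : ℤ))
  (n : ℕ) {T₀ : Matrix (Fin n) (Fin n) F} (hT₀ : T₀.IsSymm)

omit [Algebra.IsQuadraticExtension F E] in
include hπ in
/-- `X ∈ ball_a`, `Y ∈ ball_b` entrywise ⇒ `tr(X·Y) ∈ ball_{a+b}`. [cite: CasselsFrohlichANT1967, Ch. II §10] -/
theorem trace_mem_ball_of_mball {a b : ℤ} {X Y : Matrix (Fin n) (Fin n) (LocalRing E v)}
    (hX : ∀ i j (w : PlacesOver E v), Valued.v (X i j w) ≤ Valued.v (toPlace v w π) ^ a)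
    (hY : ∀ i j (w : PlacesOver E v), Valued.v (Y i j w) ≤ Valued.v (toPlace v w π) ^ b) :
    ∀ w : PlacesOver E v, Valued.v (Matrix.trace (X * Y) w) ≤ Valued.v (toPlace v w π) ^ (a + b) := by
  rw [Matrix.trace]
  exact ball_sum F E v Finset.univ fun i _ => mball_mul F E v hπ hX hY i i

include hcδ hd hT₀ hπ in
/-- **THE PHASE BOUND**: for skew `t` with `H_t = δ̂•(𝕋₀t) ∈ ball_a` (★ (B)'s `BOX` with `e₂ = 0`), hermitian `G ∈ ball_b`, and the pairing value `y = im_Q(2·tr(𝕋₀ t G))` (★ (T3a)):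
`d·(½·y) ∈ 𝔭_v^{a+b}`. [cite: Weil1964, n° 13] [cite: MoeglinVignerasWaldspurger1987, Chap. 2 II.6] [cite: Shimura1997, §13.2] -/
theorem d_mul_half_pairing_mem_primePowBall [Invertible (2 : v.adicCompletion F)] {a b : ℤ} (t : Matrix (Fin n) (Fin n) (LocalRing E v))
    (ht : (t.map (conjLocal E c v))ᵀ * gramS F E v n T₀ + gramS F E v n T₀ * t = 0)
    (htbox : ∀ i j (w : PlacesOver E v), Valued.v ((algebraMap E (LocalRing E v) δ • (gramS F E v n T₀ * t)) i j w) ≤ Valued.v (toPlace v w π) ^ a)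
    {G : Matrix (Fin n) (Fin n) (LocalRing E v)} (hG : (G.map (conjLocal E c v))ᵀ = G)
    (hGbox : ∀ i j (w : PlacesOver E v), Valued.v (G i j w) ≤ Valued.v (toPlace v w π) ^ b) {y : v.adicCompletion F}
    (hy : y = im (quadraticLocalEquiv E v c hcδ hδ).toLinearEquiv.toAddEquiv (2 * Matrix.trace (gramS F E v n T₀ * t * G))) :
    (d : v.adicCompletion F) * (⅟(2 : v.adicCompletion F) * y) ∈ primePowBall (v.adicCompletion F) (a + b) := by
  refine mem_primePowBall_of_ball_toLocalRing F E v hπ fun w => ?_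
  rw [toLocalRing_d_mul_half_pairing F E c hcδ hδ hd v n hT₀ t ht hG hy]
  exact trace_mem_ball_of_mball F E v hπ n htbox hGbox w

include hcδ hd hT₀ hπ in
/-- additive-character form: if moreover `ψ` has conductor exponent `a + b − k` where `d⁻¹`… — kept BY VALUE: any `χ : L⁺_v → ℂ` trivial on `𝔭^{a+b}` kills the phase:
`χ(d·½y) = 1`. (The caller divides by `d` with ★ (i-a) `forall_eq_one_const_mul_comp_iff`, `normAbs d⁻¹ = q^{v(d)}`.) [cite: Weil1964, n° 13] -/
theorem apply_d_mul_half_pairing_eq_one [Invertible (2 : v.adicCompletion F)] {a b : ℤ} {χ : v.adicCompletion F → ℂ}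
    (hχ : ∀ z ∈ primePowBall (v.adicCompletion F) (a + b), χ z = 1) (t : Matrix (Fin n) (Fin n) (LocalRing E v))
    (ht : (t.map (conjLocal E c v))ᵀ * gramS F E v n T₀ + gramS F E v n T₀ * t = 0)
    (htbox : ∀ i j (w : PlacesOver E v), Valued.v ((algebraMap E (LocalRing E v) δ • (gramS F E v n T₀ * t)) i j w) ≤ Valued.v (toPlace v w π) ^ a)
    {G : Matrix (Fin n) (Fin n) (LocalRing E v)} (hG : (G.map (conjLocal E c v))ᵀ = G)
    (hGbox : ∀ i j (w : PlacesOver E v), Valued.v (G i j w) ≤ Valued.v (toPlace v w π) ^ b) {y : v.adicCompletion F}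
    (hy : y = im (quadraticLocalEquiv E v c hcδ hδ).toLinearEquiv.toAddEquiv (2 * Matrix.trace (gramS F E v n T₀ * t * G))) :
    χ ((d : v.adicCompletion F) * (⅟(2 : v.adicCompletion F) * y)) = 1 :=
  hχ _ (d_mul_half_pairing_mem_primePowBall F E c hcδ hδ hd v hπ n hT₀ t ht htbox hG hGbox hy)

end Summit.HodgeConjecture.HodgeConjecture.Cruxes.HLiu418.K2LiuWitnessPhaseBound

end
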